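import Summits.BirchSwinnertonDyer.Rank1Residual.Additive.X4TamDefectMazurPrincipleOnCyclesRankOne
import Summits.BirchSwinnertonDyer.Rank1Residual.X4.OldPairOfNewVanishing
import HarnessLib

/-!
# TAM-DEFECT₂ from MAZUR'S PRINCIPLE AS A VANISHING STATEMENT: the mod-`p` plus symbol of `f` kills the `ℓ`-new cycles of its own level (cell `b2b-bsdres`, seat additive-p4, line V46)

HONEST FRAMING (verbatim, cell `b2b-bsdres`): the goal of the cell is to DELETE the COMBINATION-SHAPED
residual classes for ALL analytic-rank `≤ 1` curves over `ℚ` — "full BSD formula for every rank `≤ 1`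
curve in class `C`" assembled STRICTLY from published theorems — so that the rank-`≤ 1` remainder
becomes exactly the CONSTRUCTION-SHAPED classes, which are TYPED (missing-input Props), NOT attempted;
this is not "finishing BSD". This file: a research-route file of the CLASS-CLOSURE lane (class
N10/N11 TAM-DEFECT₂ residue, Mazur-principle sub-class): ONE typed target (`@[conjecture] def`, a
`Prop`-valued definition asserting nothing), the KERNEL theorems relating it to the V45 target BOTH
WAYS, and END theorems. Nothing booked; X4 stays CONSTRUCTION-SHAPED; no Literature fact.

## What changes relative to gen 26 (`Additive/X4TamDefectMazurPrincipleOnCycles`, line V45)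

The V45 target `MazurPrincipleOldOnCycles W p ℓ f` asserts an EXISTENTIAL over LEVEL-`M` objects:
additive `Λ₁, Λ₂ : H₁(X₀(M), ℤ) → 𝔽_p` with `[γ∞]⁺_f ≡ Λ₁(α_*{∞, γ∞}) + Λ₂(β_*{∞, γ∞})` on the
cycles of level `Mℓ` (`E'[p] ⊆ B_ℓ` read on `Hom(H₁(X₀(Mℓ), ℤ), 𝔽_p)`). Line V46 observes that
such a decomposition has two parts of different nature: (a) the functional `[·]⁺_f mod p` FACTORS
THROUGH THE IMAGE of `(α_*, β_*) : H₁(X₀(Mℓ), ℤ) → H₁(X₀(M), ℤ)²`, i.e. VANISHES ON ITS KERNEL —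
the `ℓ`-NEW CYCLES (the homology of the `ℓ`-new subvariety of `J₀(Mℓ)`); (b) the induced functional
on the image EXTENDS across the cokernel — and (b) is NOT geometry: the cokernel is Eisenstein
(Ihara's lemma, Ribet 1984 Thm. 4.1, the tree's `ribet1984_iharaLemma`) while `f` is not (one
numeral prime `q₀ ≡ 1 (mod Mℓ)` with `a_{q₀} ≢ q₀ + 1 (mod p)`), so (b) is a kernel theorem
(`X4/OldPairOfNewVanishing.exists_oldPair_of_apply_eq_zero_of_ribet1984_iharaLemma`). Hence:

* the NEW, SHARPER target `MazurPrincipleNewVanishing W p ℓ f` asserts ONLY (a): for every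
  `γ ∈ Γ₀(Mℓ)` with finite cusp `γ∞` such that the cycle `{∞, γ∞}` dies under BOTH degeneracy maps
  (`α_*{∞, γ∞} = 0 = β_*{∞, γ∞}` in `S₂(Γ₀(M))^∨`), `[γ∞]⁺_f ≡ 0 (mod p)`. A VANISHING statement for
  `f`'s own symbol at `f`'s own level: no level-`M` object, no existential; per row it is decided by
  integer linear algebra on the modular symbols of level `Mℓ` alone;
* `mazurPrincipleNewVanishing_of_oldOnCycles`: the V45 target IMPLIES the new one (unconditionally:
  `Λᵢ(0) = 0`);
* `mazurPrincipleOldOnCycles_of_newVanishing`: the new target + `ribet1984_iharaLemma` BY NAME + the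
  numeral `q₀` IMPLY the V45 target — so the two are EQUIVALENT modulo Ihara and `q₀`, and every
  V45/V43 consumer is re-keyed: `plusSymbolLevelLowersAt_of_newVanishing` (gen 20's certificate),
  `mazurPrincipleLevelLowersAt_of_newVanishing` (gen 24's target), ENDs `X4.bsdp_of_newVanishing_…`
  (rank `0` at `p ≥ 5` PUBLISHED inputs / at `p ≥ 3` modulo the announced Kim 2025 clause; rank `1`
  level `2` Cassels–Tate-free / level `3` with Cassels–Tate).

NOT in print as stated (hence a TARGET): (a) is Mazur's principle (Ribet 1990 §6 = Ribet–Stein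
2001 Thm. 3.14; Φ Eisenstein by Ribet 1990 Thm. 3.12) transplanted to the `ℓ`-new quotient
`J₀(Mℓ)/B_ℓ`: the optimal quotient map restricted to the `ℓ`-new subvariety is divisible by `p` on
the real line `H¹(E', ℤ)⁺`, i.e. (irreducibility) `E'[p] ⊆ B_ℓ`. Census unchanged (V43).

## References

* K. Ribet, W. Stein, *Lectures on Serre's conjectures* (2001), Thm. 3.14, Lemma 3.17. [cite: RibetStein2001, Thm. 3.14 and Lemma 3.17]
* K. Ribet, Invent. Math. 100 (1990), §6, Thm. 3.12. [cite: Ribet1990, §6 and Thm. 3.12]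
* K. A. Ribet, Proc. ICM 1983 (1984), Thm. 4.1. [cite: Ribet1984ICM, Thm. 4.1]
* Ju. I. Manin, Izv. Akad. Nauk SSSR 36 (1972), Thm. 3.3, Cor. 3.6. [cite: Manin1972, Thm. 3.3 (20) and Thm. 3.5 (22)]
* C.-H. Kim, Amer. J. Math. 148 (2026), Thm. 1.9 (6), Conj. 1.10. [cite: Kim2022StructureSelmer, Thm. 1.9 (6) and Conj. 1.10 (PDF p. 8)]
* J. H. Silverman, *AEC* (2009), §C.16 (`a_ℓ = 1` at split multiplicative `ℓ`). [cite: SilvermanAEC2009, §C.16 (definition of L_v(T)), PDF p. 390]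
-/

noncomputable section

open scoped MatrixGroups ModularForm Classical

open CongruenceSubgroup Finset

open Literature.NumberTheory.EllipticCurves Literature.NumberTheory.EllipticCurves.ModularForms

namespace Summit.BirchSwinnertonDyer.Rank1Residual.LevelLowering

/-! ### §1 The typed target: Mazur's principle as the vanishing on the `ℓ`-new cycles -/

section Target

variable (W : WeierstrassCurve ℚ) [W.IsGloballyMinimal] (p : ℕ) [Fact p.Prime]
  {M : ℕ} [NeZero M] (ℓ : ℕ) [Fact ℓ.Prime] (f : CuspForm (Gamma0 (M * ℓ)) 2)

/-- **MAZUR'S PRINCIPLE AS A VANISHING STATEMENT (typed target; V46).** For `W/ℚ` globally minimal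
with newform `f` at its conductor `N = Mℓ`, an odd prime `p` with `W[p]` irreducible, and a prime
`ℓ ≠ p`, `ℓ ∤ M` (so `ℓ ∥ N`), of SPLIT multiplicative reduction with `p ∣ c_ℓ(W)` such that
`ℓ ≢ 1 (mod p)` or `#W(ℚ_ℓ)[p] ≠ p²` (`ρ̄_{W,p}(Frob_ℓ)` non-scalar): the mod-`p` plus symbol of `f`
VANISHES ON THE `ℓ`-NEW CYCLES of `X₀(Mℓ)` — for every `γ ∈ Γ₀(Mℓ)` with a finite cusp `γ∞` whose
cycle `{∞, γ∞} ∈ H₁(X₀(Mℓ), ℤ)` is killed by BOTH push-forwards `α_* = (degeneracyMap0 M (Mℓ) 1 2)^∨`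
and `β_* = (degeneracyMap0 M (Mℓ) ℓ 2)^∨` (i.e. lies in the homology of the `ℓ`-new subvariety of
`J₀(Mℓ)`), `[γ∞]⁺_f ≡ 0 (mod p)`. Equivalent, modulo Ihara's lemma and one non-Eisenstein numeral,
to the V45 target `MazurPrincipleOldOnCycles` (`mazurPrincipleOldOnCycles_of_newVanishing`,
`mazurPrincipleNewVanishing_of_oldOnCycles`); it is the inclusion `E'[p] ⊆ B_ℓ` of the optimal
curve's `p`-torsion in the `ℓ`-old subvariety read on the real line of `H¹(E', 𝔽_p)`. STATUS: NOT in
print as stated — it is the printed proof of Mazur's principle (Ribet 1990 §6 = Ribet–Stein 2001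
Thm. 3.14, Lemma 3.17; Φ Eisenstein by Ribet 1990 Thm. 3.12) transplanted to the `ℓ`-new quotient of
`J₀(N)` (purely-toric transfer + irreducibility steps ours). A TARGET; nothing asserted.
[cite: RibetStein2001, Thm. 3.14 and Lemma 3.17] [cite: Ribet1990, §6 and Thm. 3.12] -/
@[conjecture] def MazurPrincipleNewVanishing : Prop :=
  IsNewformOf W f → W.conductorNorm ℤ = M * ℓ → p ≠ 2 → W.HasIrreducibleModPGaloisRep p →
    ℓ ≠ p → ¬ ℓ ∣ M → W.HasSplitMultiplicativeReductionAtPrime ℓ →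
    p ∣ (W.baseChange ℚ_[ℓ]).localTamagawaNumber ℤ_[ℓ] →
    (¬ ℓ ≡ 1 [MOD p] ∨
      Nat.card {P : (W.baseChange ℚ_[ℓ]).toAffine.Point // p • P = 0} ≠ p ^ 2) →
    ∀ γ : Gamma0 (M * ℓ), (γ : SL(2, ℤ)) 1 0 ≠ 0 →
      (degeneracyMap0 M (M * ℓ) 1 2).dualMap (periodFunctional (M * ℓ) γ) = 0 →
      (degeneracyMap0 M (M * ℓ) ℓ 2).dualMap (periodFunctional (M * ℓ) γ) = 0 →
        ((ratPlusSymbol f ((((γ : SL(2, ℤ)) 0 0 : ℤ) : ℚ) / (((γ : SL(2, ℤ)) 1 0 : ℤ) : ℚ)) : ℚ) :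
            ZMod p) = 0

end Target

/-! ### §2 The kernel theorems: the two targets are equivalent modulo Ihara and one numeral -/

section Bridge

variable {W : WeierstrassCurve ℚ} [W.IsElliptic] [W.IsGloballyMinimal] {p : ℕ} [hp : Fact p.Prime]
  {M : ℕ} [NeZero M] {ℓ : ℕ} [hℓ : Fact ℓ.Prime] {f : CuspForm (Gamma0 (M * ℓ)) 2}

/-- **(OLD) ⟹ (NV), unconditionally.** An `ℓ`-old decomposition of `[·]⁺_f mod p` on the cycles of
level `Mℓ` by additive `Λ₁, Λ₂` on `H₁(X₀(M), ℤ)` forces `[γ∞]⁺_f ≡ 0 (mod p)` on every cycle killed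
by both degeneracy maps (`Λᵢ(0) = 0`). [folklore] -/
theorem newVanishing_of_oldOnCycles
    (hOC : ∃ Λ₁ Λ₂ : Module.Dual ℂ (CuspForm (Gamma0 M) 2) → ZMod p,
      (∀ x ∈ periodHomology M, ∀ y ∈ periodHomology M, Λ₁ (x + y) = Λ₁ x + Λ₁ y) ∧
      (∀ x ∈ periodHomology M, ∀ y ∈ periodHomology M, Λ₂ (x + y) = Λ₂ x + Λ₂ y) ∧
      ∀ γ : Gamma0 (M * ℓ), (γ : SL(2, ℤ)) 1 0 ≠ 0 →
        ((ratPlusSymbol f ((((γ : SL(2, ℤ)) 0 0 : ℤ) : ℚ) / (((γ : SL(2, ℤ)) 1 0 : ℤ) : ℚ)) : ℚ) :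
            ZMod p) =
          Λ₁ ((degeneracyMap0 M (M * ℓ) 1 2).dualMap (periodFunctional (M * ℓ) γ)) +
            Λ₂ ((degeneracyMap0 M (M * ℓ) ℓ 2).dualMap (periodFunctional (M * ℓ) γ))) :
    ∀ γ : Gamma0 (M * ℓ), (γ : SL(2, ℤ)) 1 0 ≠ 0 →
      (degeneracyMap0 M (M * ℓ) 1 2).dualMap (periodFunctional (M * ℓ) γ) = 0 →
      (degeneracyMap0 M (M * ℓ) ℓ 2).dualMap (periodFunctional (M * ℓ) γ) = 0 →
        ((ratPlusSymbol f ((((γ : SL(2, ℤ)) 0 0 : ℤ) : ℚ) / (((γ : SL(2, ℤ)) 1 0 : ℤ) : ℚ)) : ℚ) :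
            ZMod p) = 0 := by
  obtain ⟨Λ₁, Λ₂, hadd₁, hadd₂, hcyc⟩ := hOC
  intro γ hc hα hβ
  rw [hcyc γ hc, hα, hβ, apply_zero_of_additive Λ₁ hadd₁, apply_zero_of_additive Λ₂ hadd₂, add_zero]

omit [W.IsElliptic] [W.IsGloballyMinimal] in
/-- **The V45 target implies the V46 target** (no Ihara, no numeral). [folklore] -/
theorem mazurPrincipleNewVanishing_of_oldOnCycles (hOC : MazurPrincipleOldOnCycles W p ℓ f) :
    MazurPrincipleNewVanishing W p ℓ f :=
  fun hf hN hp2 hirr hℓp hℓM hsplit hcℓ hns ↦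
    newVanishing_of_oldOnCycles (hOC hf hN hp2 hirr hℓp hℓM hsplit hcℓ hns)

/-- **(NV) ⟹ (OLD): the `ℓ`-old decomposition on cycles FROM the vanishing on the `ℓ`-new cycles —
Ihara BY NAME, one numeral, no multiplicity one.** `W/ℚ` globally minimal with newform `f` at level
`Mℓ`, `p` odd with `W[p]` irreducible (so every `[r]⁺_f` is `p`-integral,
`Additive/PlusSymbolIntegrality`), `ℓ ∤ M`; ONE numeral prime `q₀ ≡ 1 (mod Mℓ)` with
`a_{q₀}(W) ≢ q₀ + 1 (mod p)`; Ihara's lemma `ribet1984_iharaLemma`; and the vanishing of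
`[γ∞]⁺_f mod p` on every level-`Mℓ` cycle killed by both degeneracy maps ⟹ additive
`Λ₁, Λ₂ : H₁(X₀(M), ℤ) → 𝔽_p` with `[γ∞]⁺_f ≡ Λ₁(α_*{∞, γ∞}) + Λ₂(β_*{∞, γ∞})` for every
`γ ∈ Γ₀(Mℓ)` with finite cusp. Chain: the mod-`p` plus functional `Ψ` of `f`
(`exists_plusFunctional`) is additive and `T_r`-eigen on `H₁(X₀(Mℓ), ℤ)` and (by (NV)) kills
`ker α_* ∩ ker β_*` there; `exists_oldPair_of_apply_eq_zero_of_ribet1984_iharaLemma` extends it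
across the Eisenstein cokernel. [cite: Ribet1984ICM, Thm. 4.1]
[cite: DarmonDiamondTaylor1995, Lemma 4.28 (a), Lemma 4.30 (b), §4.5 pp. 135–137] -/
theorem oldOnCycles_of_newVanishing (hI : ribet1984_iharaLemma) (hf : IsNewformOf W f) (hp2 : p ≠ 2)
    (hirr : W.HasIrreducibleModPGaloisRep p) (hℓM : ¬ ℓ ∣ M)
    {q₀ : ℕ} (hq₀ : q₀.Prime) (hq₀1 : q₀ ≡ 1 [MOD M * ℓ])
    (haq₀ : ((W.LFunction q₀ : ℤ) : ZMod p) ≠ q₀ + 1)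
    (hNV : ∀ γ : Gamma0 (M * ℓ), (γ : SL(2, ℤ)) 1 0 ≠ 0 →
      (degeneracyMap0 M (M * ℓ) 1 2).dualMap (periodFunctional (M * ℓ) γ) = 0 →
      (degeneracyMap0 M (M * ℓ) ℓ 2).dualMap (periodFunctional (M * ℓ) γ) = 0 →
        ((ratPlusSymbol f ((((γ : SL(2, ℤ)) 0 0 : ℤ) : ℚ) / (((γ : SL(2, ℤ)) 1 0 : ℤ) : ℚ)) : ℚ) :
            ZMod p) = 0) :
    ∃ Λ₁ Λ₂ : Module.Dual ℂ (CuspForm (Gamma0 M) 2) → ZMod p,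
      (∀ x ∈ periodHomology M, ∀ y ∈ periodHomology M, Λ₁ (x + y) = Λ₁ x + Λ₁ y) ∧
      (∀ x ∈ periodHomology M, ∀ y ∈ periodHomology M, Λ₂ (x + y) = Λ₂ x + Λ₂ y) ∧
      ∀ γ : Gamma0 (M * ℓ), (γ : SL(2, ℤ)) 1 0 ≠ 0 →
        ((ratPlusSymbol f ((((γ : SL(2, ℤ)) 0 0 : ℤ) : ℚ) / (((γ : SL(2, ℤ)) 1 0 : ℤ) : ℚ)) : ℚ) :
            ZMod p) =
          Λ₁ ((degeneracyMap0 M (M * ℓ) 1 2).dualMap (periodFunctional (M * ℓ) γ)) +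
            Λ₂ ((degeneracyMap0 M (M * ℓ) ℓ 2).dualMap (periodFunctional (M * ℓ) γ)) := by
  classical
  -- newform data: rational coefficients `θ(q) = a_q(W)`, `p`-integral plus symbols
  have hf0 : IsNewform0 f := hf.1
  have hQ : coeffField f = ⊥ := IsNewformOf.coeffField_eq_bot hf
  have hθ : ∀ q : ℕ, q.Prime → (((fun n : ℕ ↦ (W.LFunction n : ℤ)) q : ℤ) : ℂ) = cuspCoeff f q :=
    fun q _ ↦ (hf.2 q).symm
  have hint : ∀ r : ℚ, ¬ p ∣ (ratPlusSymbol f r).den := fun r ↦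
    not_dvd_den_of_norm_ratCast_le_one (Additive.norm_ratPlusSymbol_le_one_of_irreducible hp2 hf hirr r)
  have hσ := inftyFunctional_cuspMatrix_apply (M * ℓ)
  -- the mod-`p` plus functional `Ψ` of `f`
  obtain ⟨P, Ψ, hσP, hHP, hTP, hΨadd, hΨσ, hΨT⟩ :=
    exists_plusFunctional (p := p) f hf0 hQ hint (fun n : ℕ ↦ (W.LFunction n : ℤ)) hθ
      (fun r ↦ (inftyFunctional (cuspMatrix r) : Module.Dual ℂ (CuspForm (Gamma0 (M * ℓ)) 2))) hσ
  have hΨ0 : Ψ 0 = 0 := by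
    have h := hΨadd 0 P.zero_mem 0 P.zero_mem
    rw [add_zero] at h
    linear_combination -h
  -- the period functional of `γ` with finite cusp is the symbol functional at `γ∞`
  have e : ∀ γ : Gamma0 (M * ℓ), (γ : SL(2, ℤ)) 1 0 ≠ 0 → periodFunctional (M * ℓ) γ =
      (inftyFunctional (cuspMatrix ((((γ : SL(2, ℤ)) 0 0 : ℤ) : ℚ) / (((γ : SL(2, ℤ)) 1 0 : ℤ) : ℚ))) :
        Module.Dual ℂ (CuspForm (Gamma0 (M * ℓ)) 2)) := by
    intro γ hc
    ext h
    rw [periodFunctional_apply, cuspSymbol, if_neg hc, hσ]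
  -- (NV) for `Ψ` on `H₁(X₀(Mℓ), ℤ)`
  have hvan : ∀ z ∈ periodHomology (M * ℓ), (degeneracyMap0 M (M * ℓ) 1 2).dualMap z = 0 →
      (degeneracyMap0 M (M * ℓ) ℓ 2).dualMap z = 0 → Ψ z = 0 := by
    intro z hz hα hβ
    have hz' : z ∈ (periodHomology (M * ℓ) : Set (Module.Dual ℂ (CuspForm (Gamma0 (M * ℓ)) 2))) := hz
    rw [coe_periodHomology_eq_range] at hz'
    obtain ⟨γ, rfl⟩ := hz'
    by_cases hc : (γ : SL(2, ℤ)) 1 0 = 0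
    · rw [periodFunctional_eq_zero_of_apply_eq_zero γ hc, hΨ0]
    · rw [e γ hc, hΨσ]
      exact hNV γ hc hα hβ
  -- extension across the cokernel (Ihara BY NAME)
  obtain ⟨Λ₁, Λ₂, hadd₁, hadd₂, hold⟩ :=
    exists_oldPair_of_apply_eq_zero_of_ribet1984_iharaLemma hI hℓM hp2 (fun n : ℕ ↦ (W.LFunction n : ℤ))
      Ψ (fun x hx y hy ↦ hΨadd x (hHP hx) y (hHP hy)) (fun r hr _ z hz ↦ hΨT r hr z (hHP hz)) hvan
      hq₀ hq₀1 haq₀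
  refine ⟨Λ₁, Λ₂, hadd₁, hadd₂, fun γ hc ↦ ?_⟩
  rw [← hΨσ, ← e γ hc]
  exact hold _ (periodFunctional_mem_periodHomology (M * ℓ) γ)

/-- **The V46 target implies the V45 target** (+ Ihara BY NAME + the numeral `q₀`): with
`mazurPrincipleNewVanishing_of_oldOnCycles`, the two typed targets are EQUIVALENT modulo
`ribet1984_iharaLemma` and one prime `q₀ ≡ 1 (mod Mℓ)` with `a_{q₀} ≢ q₀ + 1 (mod p)`.
[cite: Ribet1984ICM, Thm. 4.1] [cite: RibetStein2001, Thm. 3.14 and Lemma 3.17] -/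
theorem mazurPrincipleOldOnCycles_of_newVanishing (hI : ribet1984_iharaLemma)
    {q₀ : ℕ} (hq₀ : q₀.Prime) (hq₀1 : q₀ ≡ 1 [MOD M * ℓ])
    (haq₀ : ((W.LFunction q₀ : ℤ) : ZMod p) ≠ q₀ + 1)
    (hNV : MazurPrincipleNewVanishing W p ℓ f) : MazurPrincipleOldOnCycles W p ℓ f :=
  fun hf hN hp2 hirr hℓp hℓM hsplit hcℓ hns ↦
    oldOnCycles_of_newVanishing hI hf hp2 hirr hℓM hq₀ hq₀1 haq₀ (hNV hf hN hp2 hirr hℓp hℓM hsplit hcℓ hns)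

/-- **Gen 20's level-lowering certificate FROM the vanishing on the `ℓ`-new cycles** (+ Ihara BY
NAME + `q₀`): `PlusSymbolLevelLowersAt W p f ℓ` — the composition of `oldOnCycles_of_newVanishing`
with the V45 chain `plusSymbolLevelLowersAt_of_oldOnCycles`. [cite: Ribet1984ICM, Thm. 4.1]
[cite: Manin1972, Thm. 3.3 (20) and Thm. 3.5 (22)] -/
theorem plusSymbolLevelLowersAt_of_newVanishing (hI : ribet1984_iharaLemma) (hf : IsNewformOf W f)
    (hN : W.conductorNorm ℤ = M * ℓ) (hp2 : p ≠ 2) (hirr : W.HasIrreducibleModPGaloisRep p)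
    (hℓM : ¬ ℓ ∣ M) (hsplit : W.HasSplitMultiplicativeReductionAtPrime ℓ)
    {q₀ : ℕ} (hq₀ : q₀.Prime) (hq₀1 : q₀ ≡ 1 [MOD M * ℓ])
    (haq₀ : ((W.LFunction q₀ : ℤ) : ZMod p) ≠ q₀ + 1)
    (hNV : ∀ γ : Gamma0 (M * ℓ), (γ : SL(2, ℤ)) 1 0 ≠ 0 →
      (degeneracyMap0 M (M * ℓ) 1 2).dualMap (periodFunctional (M * ℓ) γ) = 0 →
      (degeneracyMap0 M (M * ℓ) ℓ 2).dualMap (periodFunctional (M * ℓ) γ) = 0 →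
        ((ratPlusSymbol f ((((γ : SL(2, ℤ)) 0 0 : ℤ) : ℚ) / (((γ : SL(2, ℤ)) 1 0 : ℤ) : ℚ)) : ℚ) :
            ZMod p) = 0) :
    PlusSymbolLevelLowersAt W p f ℓ :=
  plusSymbolLevelLowersAt_of_oldOnCycles hI hf hN hp2 hirr hℓM hsplit hq₀ hq₀1 haq₀
    (oldOnCycles_of_newVanishing hI hf hp2 hirr hℓM hq₀ hq₀1 haq₀ hNV)

/-- **Gen 24's target FOLLOWS from the V46 target** (+ Ihara BY NAME + the numeral `q₀`).
[cite: RibetStein2001, Thm. 3.14] [cite: Ribet1984ICM, Thm. 4.1] -/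
theorem mazurPrincipleLevelLowersAt_of_newVanishing (hI : ribet1984_iharaLemma)
    {q₀ : ℕ} (hq₀ : q₀.Prime) (hq₀1 : q₀ ≡ 1 [MOD M * ℓ])
    (haq₀ : ((W.LFunction q₀ : ℤ) : ZMod p) ≠ q₀ + 1)
    (hNV : MazurPrincipleNewVanishing W p ℓ f) : MazurPrincipleLevelLowersAt W p f ℓ :=
  mazurPrincipleLevelLowersAt_of_oldOnCycles hI hq₀ hq₀1 haq₀
    (mazurPrincipleOldOnCycles_of_newVanishing hI hq₀ hq₀1 haq₀ hNV)

end Bridge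

end Summit.BirchSwinnertonDyer.Rank1Residual.LevelLowering

/-! ### §3 END: the TAM-DEFECT₂ rows with a Mazur-principle prime close modulo the V46 target -/

namespace Summit.BirchSwinnertonDyer.Rank1Residual.X4

open Complex WeierstrassCurve Literature.NumberTheory.EllipticCurves.Rank1Residual
  Literature.NumberTheory.EllipticCurves.Rank1Residual.Typed
  Summit.BirchSwinnertonDyer.Rank1Residual.LevelLowering

variable (W : WeierstrassCurve ℚ) [W.IsElliptic] [W.IsGloballyMinimal] (p : ℕ) [Fact p.Prime]

/-- **TAM-DEFECT₂ CLOSURE at `p ≥ 5` FROM THE VANISHING ON THE `ℓ`-NEW CYCLES** (MP sub-class;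
corner included). `W/ℚ` globally minimal of analytic rank `0`, `p ≥ 5`, `ρ̄_{E,p}` onto, a
conductor-level datum `D` at level `Mℓ = N` with `p ∤ c_D` and the period transfer, `#Ш_an` a
`p`-unit, `ord_p ∏ c ≤ 2`, a split multiplicative `ℓ ∤ M`, `ℓ ≠ p`, with `p ∣ c_ℓ` and
(`ℓ ≢ 1 (mod p)` ∨ `#E(ℚ_ℓ)[p] ≠ p²`), a numeral prime `q₀ ≡ 1 (mod Mℓ)` with
`a_{q₀} ≢ q₀ + 1 (mod p)`: IF the typed target `MazurPrincipleNewVanishing W p ℓ D.f` holds THEN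
**`BSD(E,p)`** — from Ihara's lemma `ribet1984_iharaLemma` (BY NAME), Kim 2026 Thm. 1.8 (6),
Cassels–Tate, GZK, modularity (PUBLISHED) and the tree's V45/V46 chain. Nothing booked.
[cite: Kim2022StructureSelmer, Thm. 1.9 (6) and Conj. 1.10 (PDF p. 8)] [cite: RibetStein2001, Thm. 3.14]
[cite: Ribet1984ICM, Thm. 4.1] [cite: SilvermanAEC2009, Thm. X.4.14] -/
theorem bsdp_of_newVanishing_of_tamagawa_le_two_of_shaAn_unit_of_five_le
    (hI : ribet1984_iharaLemma)
    (hKimk : Kim2026.rankZero_le_padicValNat_sha_of_kuriharaNumber_ne_zero)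
    (hE67c : Kim2026.rankZero_padicValNat_sha_add_le_of_forall_pow_dvd_kuriharaNumber_cyclicLevel)
    (hCT : exists_casselsTate_pairing (K := ℚ))
    (hGZK : rank_eq_analyticRank_of_analyticRank_le_one) (hmod : hasEntireLFunction_rat)
    (hp : 5 ≤ p) (hr : W.analyticRank = 0) (hsurj : W.HasSurjectiveModNGaloisRep p)
    {M : ℕ} [NeZero M] {ℓ : ℕ} [Fact ℓ.Prime] [NeZero (M * ℓ)]
    (D : ModularParametrizationData W (M * ℓ)) (hN : W.conductorNorm ℤ = M * ℓ)
    (hc : ¬ (p : ℤ) ∣ D.maninConstant)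
    (hper : ∃ u : ℚ, ‖(u : ℚ_[p])‖ = 1 ∧ W.realPeriodRat = u * plusPeriod D.f)
    {q' : ℚ} (hq' : shaAn W = (q' : ℂ)) (hv : padicValRat p q' = 0)
    (hc2 : padicValNat p W.tamagawaProduct ≤ 2)
    (hℓp : ℓ ≠ p) (hℓM : ¬ ℓ ∣ M) (hsplit : W.HasSplitMultiplicativeReductionAtPrime ℓ)
    (hcℓ : p ∣ (W.baseChange ℚ_[ℓ]).localTamagawaNumber ℤ_[ℓ])
    (hns : ¬ ℓ ≡ 1 [MOD p] ∨
      Nat.card {P : (W.baseChange ℚ_[ℓ]).toAffine.Point // p • P = 0} ≠ p ^ 2)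
    {q₀ : ℕ} (hq₀ : q₀.Prime) (hq₀1 : q₀ ≡ 1 [MOD M * ℓ])
    (haq₀ : ((W.LFunction q₀ : ℤ) : ZMod p) ≠ q₀ + 1)
    (hNV : MazurPrincipleNewVanishing W p ℓ D.f) : BSDp W p :=
  bsdp_of_oldOnCycles_of_tamagawa_le_two_of_shaAn_unit_of_five_le W p hI hKimk hE67c hCT hGZK hmod hp
    hr hsurj D hN hc hper hq' hv hc2 hℓp hℓM hsplit hcℓ hns hq₀ hq₀1 haq₀
    (mazurPrincipleOldOnCycles_of_newVanishing hI hq₀ hq₀1 haq₀ hNV)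

/-- **The `p ≥ 3` tower twin from the vanishing on the `ℓ`-new cycles, CONDITIONAL on the announced
Kim 2025 clause** (`hK25s`, flag `Kim2025-preprint`) — the N11 TAM-DEFECT₂(3) block: analytic rank
`0`, `ρ̄_{E,p^n}` onto for all `n`, conductor-level datum at level `Mℓ` with the period transfer,
`#Ш_an` a `p`-unit, `ord_p ∏c ≤ 2`, a split multiplicative `ℓ ∤ M`, `ℓ ≠ p`, with `p ∣ c_ℓ` and
(`ℓ ≢ 1 (mod p)` ∨ `#E(ℚ_ℓ)[p] ≠ p²`), the numeral `q₀`, Ihara's lemma BY NAME, and the typed target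
at `(W, p, ℓ, D.f)` ⟹ `BSD(E,p)`. [claim: Kim2025RefinedTNC, status: under-review]
[cite: Kim2025RefinedTNC, Thm. 1.1 ("BSD") (ANNOUNCED, OPEN binder)] [cite: RibetStein2001, Thm. 3.14]
[cite: Ribet1984ICM, Thm. 4.1] [cite: Kim2022StructureSelmer, Conj. 1.10 (PDF p. 8)] -/
theorem bsdp_of_newVanishing_of_tamagawa_le_two_of_shaAn_unit_of_kim2025_OPEN
    (hI : ribet1984_iharaLemma)
    (hK25s : Kim2025.thm11_kimShaLength_of_integralPeriod_OPEN)
    (hCT : exists_casselsTate_pairing (K := ℚ))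
    (hGZK : rank_eq_analyticRank_of_analyticRank_le_one) (hmod : hasEntireLFunction_rat)
    (hp3 : 3 ≤ p) (hr : W.analyticRank = 0) (htower : ∀ n : ℕ, W.HasSurjectiveModNGaloisRep (p ^ n : ℕ))
    {M : ℕ} [NeZero M] {ℓ : ℕ} [Fact ℓ.Prime] [NeZero (M * ℓ)]
    (D : ModularParametrizationData W (M * ℓ)) (hN : W.conductorNorm ℤ = M * ℓ)
    (hper : ∃ u : ℚ, ‖(u : ℚ_[p])‖ = 1 ∧ W.realPeriodRat = u * plusPeriod D.f)
    {q' : ℚ} (hq' : shaAn W = (q' : ℂ)) (hv : padicValRat p q' = 0)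
    (hc2 : padicValNat p W.tamagawaProduct ≤ 2)
    (hℓp : ℓ ≠ p) (hℓM : ¬ ℓ ∣ M) (hsplit : W.HasSplitMultiplicativeReductionAtPrime ℓ)
    (hcℓ : p ∣ (W.baseChange ℚ_[ℓ]).localTamagawaNumber ℤ_[ℓ])
    (hns : ¬ ℓ ≡ 1 [MOD p] ∨
      Nat.card {P : (W.baseChange ℚ_[ℓ]).toAffine.Point // p • P = 0} ≠ p ^ 2)
    {q₀ : ℕ} (hq₀ : q₀.Prime) (hq₀1 : q₀ ≡ 1 [MOD M * ℓ])
    (haq₀ : ((W.LFunction q₀ : ℤ) : ZMod p) ≠ q₀ + 1)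
    (hNV : MazurPrincipleNewVanishing W p ℓ D.f) : BSDp W p :=
  bsdp_of_oldOnCycles_of_tamagawa_le_two_of_shaAn_unit_of_kim2025_OPEN W p hI hK25s hCT hGZK hmod hp3
    hr htower D hN hper hq' hv hc2 hℓp hℓM hsplit hcℓ hns hq₀ hq₀1 haq₀
    (mazurPrincipleOldOnCycles_of_newVanishing hI hq₀ hq₀1 haq₀ hNV)

/-- **RANK-ONE `p`-UNIT TAMAGAWA ROWS at `p ≥ 5`, Cassels–Tate-free, FROM THE VANISHING ON THE
`ℓ`-NEW CYCLES.** Analytic rank `1`, `p ≥ 5`, `ρ̄_{E,p}` onto and the tower, a conductor-level datum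
at `N = Mℓ₀` with `p ∤ c_D` and the period transfer, a split `ℓ₀ ∤ M`, `ℓ₀ ≠ p`, with `p ∣ c_{ℓ₀}`
and (`ℓ₀ ≢ 1 (mod p)` ∨ `#E(ℚ_{ℓ₀})[p] ≠ p²`), the numeral `q₀`, ONE Kurihara number
`δ̃_ℓ ≢ 0 (mod p²)` at a cyclic level-`2` Kolyvagin prime `ℓ`, `#Ш_an` a `p`-unit; Ihara's lemma BY
NAME; the typed target `MazurPrincipleNewVanishing W p ℓ₀ D.f` ⟹ `BSD(E,p)` (Kim Thm. 1.8 (3), GZK,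
modularity). [cite: Kim2022StructureSelmer, Thm. 1.8 (3); Thm. 1.9 (3)–(5) (PDF pp. 7–8)]
[cite: RibetStein2001, Thm. 3.14] [cite: Ribet1984ICM, Thm. 4.1] -/
theorem bsdp_rankOne_of_newVanishing_levelTwo_of_shaAn_unit_of_five_le
    (hI : ribet1984_iharaLemma)
    (hE73 : Kim2026.kuriharaPartial_vanishingOrder_eq_padicValNat_sha_add_partialInfty_of_maninConstant)
    (hGZK : rank_eq_analyticRank_of_analyticRank_le_one) (hmod : hasEntireLFunction_rat)
    (hp : 5 ≤ p) (hsurj : W.HasSurjectiveModNGaloisRep p)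
    (htower : ∀ n : ℕ, W.HasSurjectiveModNGaloisRep (p ^ n : ℕ)) (hr : W.analyticRank = 1)
    {M : ℕ} [NeZero M] {ℓ₀ : ℕ} [Fact ℓ₀.Prime] [NeZero (M * ℓ₀)]
    (D : ModularParametrizationData W (M * ℓ₀)) (hN : W.conductorNorm ℤ = M * ℓ₀)
    (hc : ¬ (p : ℤ) ∣ D.maninConstant)
    (hper : ∃ u : ℚ, ‖(u : ℚ_[p])‖ = 1 ∧ W.realPeriodRat = u * plusPeriod D.f)
    (hℓ₀p : ℓ₀ ≠ p) (hℓ₀M : ¬ ℓ₀ ∣ M) (hsplit : W.HasSplitMultiplicativeReductionAtPrime ℓ₀)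
    (hcℓ₀ : p ∣ (W.baseChange ℚ_[ℓ₀]).localTamagawaNumber ℤ_[ℓ₀])
    (hns : ¬ ℓ₀ ≡ 1 [MOD p] ∨
      Nat.card {P : (W.baseChange ℚ_[ℓ₀]).toAffine.Point // p • P = 0} ≠ p ^ 2)
    {q₀ : ℕ} (hq₀ : q₀.Prime) (hq₀1 : q₀ ≡ 1 [MOD M * ℓ₀])
    (haq₀ : ((W.LFunction q₀ : ℤ) : ZMod p) ≠ q₀ + 1)
    (hNV : MazurPrincipleNewVanishing W p ℓ₀ D.f)
    (ℓ : ℕ) [Fact ℓ.Prime] (hℓ : Kato.IsKolyvaginPrime W p 2 ℓ)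
    (hcyc : Nat.card {P : ((WeierstrassCurve.integralModelInt W).map
        (Int.castRingHom (ZMod ℓ))).toAffine.Point // p • P = 0} ≤ p)
    (ψ : (ℓ' : ℕ) → (ZMod ℓ')ˣ →* Multiplicative (ZMod (p ^ 2)))
    (hψ : Function.Surjective (ψ ℓ)) (hδ : kuriharaNumber D.f (p ^ 2) ℓ ψ ≠ 0)
    {q : ℚ} (hq : shaAn W = (q : ℂ)) (hv : padicValRat p q = 0) : BSDp W p :=
  bsdp_rankOne_of_oldOnCycles_levelTwo_of_shaAn_unit_of_five_le W p hI hE73 hGZK hmod hp hsurj htower hr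
    D hN hc hper hℓ₀p hℓ₀M hsplit hcℓ₀ hns hq₀ hq₀1 haq₀
    (mazurPrincipleOldOnCycles_of_newVanishing hI hq₀ hq₀1 haq₀ hNV) ℓ hℓ hcyc ψ hψ hδ hq hv

/-- **RANK-ONE `ord_p ∏c = 2` ROWS at `p ≥ 5` with Cassels–Tate, FROM THE VANISHING ON THE
`ℓ`-NEW CYCLES**: as `bsdp_rankOne_of_newVanishing_levelTwo_of_shaAn_unit_of_five_le` but with ONE
Kurihara number `δ̃_ℓ ≢ 0 (mod p³)` at a cyclic level-`3` Kolyvagin prime and the Cassels–Tate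
pairing. [cite: Kim2022StructureSelmer, Thm. 1.8 (3); Thm. 1.9 (3)–(5) (PDF pp. 7–8)]
[cite: RibetStein2001, Thm. 3.14] [cite: Ribet1984ICM, Thm. 4.1] [cite: SilvermanAEC2009, Thm. X.4.14] -/
theorem bsdp_rankOne_of_newVanishing_levelThree_of_casselsTate_of_shaAn_unit_of_five_le
    (hI : ribet1984_iharaLemma)
    (hE73 : Kim2026.kuriharaPartial_vanishingOrder_eq_padicValNat_sha_add_partialInfty_of_maninConstant)
    (hCT : exists_casselsTate_pairing (K := ℚ))
    (hGZK : rank_eq_analyticRank_of_analyticRank_le_one) (hmod : hasEntireLFunction_rat)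
    (hp : 5 ≤ p) (hsurj : W.HasSurjectiveModNGaloisRep p)
    (htower : ∀ n : ℕ, W.HasSurjectiveModNGaloisRep (p ^ n : ℕ)) (hr : W.analyticRank = 1)
    {M : ℕ} [NeZero M] {ℓ₀ : ℕ} [Fact ℓ₀.Prime] [NeZero (M * ℓ₀)]
    (D : ModularParametrizationData W (M * ℓ₀)) (hN : W.conductorNorm ℤ = M * ℓ₀)
    (hc : ¬ (p : ℤ) ∣ D.maninConstant)
    (hper : ∃ u : ℚ, ‖(u : ℚ_[p])‖ = 1 ∧ W.realPeriodRat = u * plusPeriod D.f)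
    (hℓ₀p : ℓ₀ ≠ p) (hℓ₀M : ¬ ℓ₀ ∣ M) (hsplit : W.HasSplitMultiplicativeReductionAtPrime ℓ₀)
    (hcℓ₀ : p ∣ (W.baseChange ℚ_[ℓ₀]).localTamagawaNumber ℤ_[ℓ₀])
    (hns : ¬ ℓ₀ ≡ 1 [MOD p] ∨
      Nat.card {P : (W.baseChange ℚ_[ℓ₀]).toAffine.Point // p • P = 0} ≠ p ^ 2)
    {q₀ : ℕ} (hq₀ : q₀.Prime) (hq₀1 : q₀ ≡ 1 [MOD M * ℓ₀])
    (haq₀ : ((W.LFunction q₀ : ℤ) : ZMod p) ≠ q₀ + 1)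
    (hNV : MazurPrincipleNewVanishing W p ℓ₀ D.f)
    (ℓ : ℕ) [Fact ℓ.Prime] (hℓ : Kato.IsKolyvaginPrime W p 3 ℓ)
    (hcyc : Nat.card {P : ((WeierstrassCurve.integralModelInt W).map
        (Int.castRingHom (ZMod ℓ))).toAffine.Point // p • P = 0} ≤ p)
    (ψ : (ℓ' : ℕ) → (ZMod ℓ')ˣ →* Multiplicative (ZMod (p ^ 3)))
    (hψ : Function.Surjective (ψ ℓ)) (hδ : kuriharaNumber D.f (p ^ 3) ℓ ψ ≠ 0)
    {q : ℚ} (hq : shaAn W = (q : ℂ)) (hv : padicValRat p q = 0) : BSDp W p :=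
  bsdp_rankOne_of_oldOnCycles_levelThree_of_casselsTate_of_shaAn_unit_of_five_le W p hI hE73 hCT hGZK
    hmod hp hsurj htower hr D hN hc hper hℓ₀p hℓ₀M hsplit hcℓ₀ hns hq₀ hq₀1 haq₀
    (mazurPrincipleOldOnCycles_of_newVanishing hI hq₀ hq₀1 haq₀ hNV) ℓ hℓ hcyc ψ hψ hδ hq hv

end Summit.BirchSwinnertonDyer.Rank1Residual.X4

end
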